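import Summits.BirchSwinnertonDyer.Rank1Residual.X9.TransportPairs
import HarnessLib

/-!
# Class X9: the Greenberg–Vatsal transport consumers KEYED ON THE TORSION ISOMORPHISM `A[p] ≅ E[p]` (integer-model form)
# — the currency-free layer below the Kraus–Oesterlé congruence lists

HONEST FRAMING (cell `b2b-bsdres-*`, verbatim): the cell deletes COMBINATION-SHAPED residual classes of
the rank-≤1 BSD formula from PUBLISHED theorems only and TYPES the construction-shaped remainder; this
is not "finishing BSD". Class X9 (good ordinary `p ≥ 5`, `ρ̄_{E,p}` irreducible and not surjective) stays
TYPED at class level; everything here is GENERIC (symbolic `W`, `A`); no named fact is introduced; nothing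
is booked by this unit (the lane books, the referee rules). Unit `b2b-bsdres-x9`, gen 47.

## Why this file (the KO92 clause defect, 2026-08-27)

The ARM-P audit of the cited-facts cell (`pub/bsd-cited`, sheet `D-AUDIT-r07-Q41-KO92-LS18.md`, register
R-20 `KO92-Prop4-(ii)b-frobeniusTrace-offset`) found that the Literature statement
`KrausOesterle1992.prop4_torsionIso_of_congruences` transcribes Kraus–Oesterlé's clause "`ℓ ∣ NN'`,
`ℓ² ∤ NN'` ⇒ `a_ℓ a'_ℓ ≡ ℓ + 1 (mod p)`" over the tree's `frobeniusTrace`, which at the MULTIPLICATIVE curve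
of such a pair is `2` / `0` (`= 1 + a_ℓ`, tree theorems `X11b.LocalTorsion.frobeniusTrace_eq_two_of_split` /
`…_eq_zero_of_nonsplit`), not the Hasse–Weil coefficient `a_ℓ = ±1` that the paper multiplies (Math. Ann. 293,
p. 263 L8–9). Every X9 transport record (`X9/TransportSweepA–H`, `TransportPairs{,B,C,D}`,
`HessePartnerRecordsO`, `S4DescentPairsZimmertE`: 35 record theorems, 31 pairs, 29 targets — x9 GEN 47 census
`HOME/b2b-bsdres-x9/g47/X9-KO92-exposure.tsv`) DISPLAYS that list as its binder `hcong` on a pair with a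
sub-bound prime of valuation one in `N_E N_A`, so each is VACUOUS AS TYPED (the two engines certified PRINT's
clause, which holds). The repair re-keys the records on the corrected Literature twin
(`…_hasseWeil`, typing-layer target T-Q41-1). THIS file is the part of the repair that does not depend on
any Kraus–Oesterlé statement: the integer-model transport theorems of gen 15/16
(`bsdp_of_ainvs_of_bsdpPartner_of_congruences{,_of_analyticRank_le_one}`,
`bsdp_of_ainvs_of_conductor_lt_of_congruences_of_analyticRank_le_one`) with C1 taken as the
`Γ_ℚ`-EQUIVARIANT ISOMORPHISM `A[p] ≃ E[p]` itself (`hC1`) instead of a congruence list — so that every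
finite criterion producing `hC1` (Kraus–Oesterlé in either currency, Fisher's families, a kernel Sturm
argument) plugs in by one line, and no record depends on the currency of a criterion it does not use.

## Contents (all sorry-free; axioms standard)

* `bsdp_of_ainvs_of_bsdpPartner_of_torsionIso_of_analyticRank_le_one` — target of analytic rank `≤ 1`, partner of
  analytic rank `≤ 1` with `BSDp A p` displayed; Galois / reduction data of both decided from the integer models.
* `bsdp_of_ainvs_of_bsdpPartner_of_torsionIso` — the same for a target of analytic rank `0` (no `hC3`).
* `bsdp_of_ainvs_of_conductor_lt_of_torsionIso_of_analyticRank_le_one` — partner of conductor `< 5000`, `BSD(A,p)`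
  DISCHARGED by Miller 2011 / Creutz–Miller 2012 (`hMiller`).
* `hasGoodReductionAtPrime_and_not_dvd_and_irr_of_ainvs` — the kernel-decided target data packaged once
  (good ordinary at `p`, `E[p]` irreducible by a Frobenius witness), shared by the three.

References: Greenberg–Vatsal, Invent. Math. 142 (2000) Thm. (1.4); Burungale–Castella–Skinner, IMRN 2025
Thm. 1.1.2 (a); Greenberg, LNM 1716 (1999) Thm. 4.1; Perrin-Riou 1987 §1.4; Balakrishnan–Müller–Stein 2016
Thm. 1.7; Mazur 1978 Prop. 6.3 (1); Miller 2011 Thm. 1.2; Silverman AEC VII.1; Kraus–Oesterlé, Math. Ann. 293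
(1992) Prop. 4 (motivation of the repair only — not used here).
-/

set_option autoImplicit false

noncomputable section

open scoped Classical MatrixGroups ModularForm

open CongruenceSubgroup WeierstrassCurve Literature.NumberTheory.EllipticCurves
  Literature.NumberTheory.EllipticCurves.ModularForms Literature.NumberTheory.EllipticCurves.Rank1Residual
  Literature.NumberTheory.EllipticCurves.Rank1Residual.Typed
  Literature.NumberTheory.EllipticCurves.Rank1Residual.X11RankOneCertificates
  Summit.BirchSwinnertonDyer.BirchSwinnertonDyer.Rank1Residual.IntModel
  Summit.BirchSwinnertonDyer.BirchSwinnertonDyer.Rank1Residual.X11RankOne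
  Summit.BirchSwinnertonDyer.Rank1Residual.X11b

namespace Summit.BirchSwinnertonDyer.Rank1Residual.X9

/-! ### §0. The kernel-decided target data, packaged -/

/-- **Good ordinary reduction at `p` and irreducibility of `E[p]` from the integer model.** For a globally minimal
`W` with integral model `[a₁,…,a₆]`: `p ∤ Δ` gives good reduction at `p` (Silverman VII.5.1); the kernel point count
`#Ẽ(𝔽_p) = n_p` with `p ∤ p + 1 − n_p` gives `p ∤ a_p`; a good prime `ℓ ≠ p` with `#Ẽ(𝔽_ℓ) = n` and
`X² − (ℓ + 1 − n)X + ℓ` root-free mod `p` gives `E[p]` irreducible (Mazur 1978 Prop. 6.3 (1): a reducible `E[p]`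
has `a_ℓ ≡ ε(ℓ) + ℓε(ℓ)⁻¹`, a root of the characteristic polynomial mod `p`). The preamble shared by the three
transport theorems below and by gens 15/16. [cite: Mazur1978, §6 Prop. 6.3 (1) (p. 153)] [cite: SilvermanAEC2009, VII.1 Remark 1.1] -/
theorem hasGoodReductionAtPrime_and_not_dvd_and_irr_of_ainvs
    (a1 a2 a3 a4 a6 : ℤ) {W : WeierstrassCurve ℚ} [W.IsElliptic] [W.IsGloballyMinimal]
    (hW : integralModelInt W = ⟨a1, a2, a3, a4, a6⟩)
    (p ℓ n np : ℕ) [Fact p.Prime] [Fact ℓ.Prime]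
    (hpΔ : ¬ (p : ℤ) ∣ discOf [a1, a2, a3, a4, a6])
    (hcardp : Nat.card (((⟨a1, a2, a3, a4, a6⟩ : WeierstrassCurve ℤ).map
      (Int.castRingHom (ZMod p))).toAffine.Point) = np)
    (hordp : ¬ (p : ℤ) ∣ (p : ℤ) + 1 - np)
    (hℓp : ℓ ≠ p) (hℓΔ : ¬ (ℓ : ℤ) ∣ discOf [a1, a2, a3, a4, a6])
    (hcard : Nat.card (((⟨a1, a2, a3, a4, a6⟩ : WeierstrassCurve ℤ).map
      (Int.castRingHom (ZMod ℓ))).toAffine.Point) = n)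
    (hnoroot : ∀ t : ℕ, t < p → ¬ (p : ℤ) ∣ (t : ℤ) ^ 2 - ((ℓ : ℤ) + 1 - n) * t + ℓ) :
    W.HasGoodReductionAtPrime p ∧ ¬ (p : ℤ) ∣ W.frobeniusTrace p ∧ W.HasIrreducibleModPGaloisRep p := by
  have hΔ : (⟨a1, a2, a3, a4, a6⟩ : WeierstrassCurve ℤ).Δ = discOf [a1, a2, a3, a4, a6] :=
    intCurve_Δ a1 a2 a3 a4 a6
  refine ⟨hasGoodReductionAtPrime_of_not_dvd W p (by rw [minimalDiscriminantInt_eq hW, hΔ]; exact hpΔ),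
    by rw [frobeniusTrace_eq hW hcardp]; exact hordp, ?_⟩
  refine hasIrreducibleModPGaloisRep_of_intModel_of_noroot hW p ℓ hℓp (by rw [hΔ]; exact hℓΔ) hcard
    (forall_zmod_of_forall_lt fun t ht h0 ↦ hnoroot t ht ?_)
  rw [← ZMod.intCast_zmod_eq_zero_iff_dvd]
  push_cast at h0 ⊢
  linear_combination h0

/-- **Good ordinary reduction at `p` of the PARTNER from its integer model** (`p ∤ Δ'`, `#Ã(𝔽_p) = n'_p` with
`p ∤ p + 1 − n'_p`). [cite: SilvermanAEC2009, VII.1 Remark 1.1] -/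
theorem hasGoodReductionAtPrime_and_not_dvd_of_ainvs
    (b1 b2 b3 b4 b6 : ℤ) {A : WeierstrassCurve ℚ} [A.IsElliptic] [A.IsGloballyMinimal]
    (hA : integralModelInt A = ⟨b1, b2, b3, b4, b6⟩) (p npA : ℕ) [Fact p.Prime]
    (hpΔA : ¬ (p : ℤ) ∣ discOf [b1, b2, b3, b4, b6])
    (hcardpA : Nat.card (((⟨b1, b2, b3, b4, b6⟩ : WeierstrassCurve ℤ).map
      (Int.castRingHom (ZMod p))).toAffine.Point) = npA)
    (hordpA : ¬ (p : ℤ) ∣ (p : ℤ) + 1 - npA) :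
    A.HasGoodReductionAtPrime p ∧ ¬ (p : ℤ) ∣ A.frobeniusTrace p := by
  have hΔA : (⟨b1, b2, b3, b4, b6⟩ : WeierstrassCurve ℤ).Δ = discOf [b1, b2, b3, b4, b6] :=
    intCurve_Δ b1 b2 b3 b4 b6
  exact ⟨hasGoodReductionAtPrime_of_not_dvd A p (by rw [minimalDiscriminantInt_eq hA, hΔA]; exact hpΔA),
    by rw [frobeniusTrace_eq hA hcardpA]; exact hordpA⟩

/-! ### §1. Transport keyed on the torsion isomorphism (integer models) -/

/-- **Target of analytic rank `≤ 1`, partner of analytic rank `≤ 1`, both by globally minimal INTEGER models, C1 = the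
`Γ_ℚ`-equivariant isomorphism `A[p] ≃ E[p]` itself.** Gen 16's
`bsdp_of_ainvs_of_bsdpPartner_of_congruences_of_analyticRank_le_one` with the Kraus–Oesterlé list `hKO`/`hcong`
replaced by its OUTPUT `hC1` (so the theorem is independent of the currency of any congruence criterion). Target `W`,
model `[a₁,…,a₆]`: `p ∤ Δ`, `#Ẽ(𝔽_p) = n_p` with `p ∤ p + 1 − n_p`, a Frobenius witness `ℓ` for the irreducibility
of `E[p]`; partner `A`, model `[a′₁,…,a′₆]`: `p ∤ Δ′`, `#Ã(𝔽_p) = n′_p` with `p ∤ p + 1 − n′_p`. Remaining binders: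
PUBLISHED `hBCS … hGZK`; FINITE `r_an(E) ≤ 1`, `r_an(A) ≤ 1`, `BSDp A p`, C2 `hcertA`, C3 for the partner `hSchA` and
for the target `hC3` (each vacuous in rank `0`), C1 `hC1`. Proof: the packaged target data (§0) and gen 15's
`bsdp_of_bsdpPartner_of_partnerRank_le_one_of_irr` (BCS 2025 (a) + `BSD(A,p)` ⟹ Mazur's main conjecture with
`μ = 0` for `A`; Greenberg–Vatsal Thm. (1.4) along `hC1`; Greenberg 4.1 / Perrin-Riou–Schneider + GZK).
[cite: GreenbergVatsal2000, Thm. (1.4) (arXiv p. 5)] [cite: BurungaleCastellaSkinner2025, Thm. 1.1.2 (a) (p. 2 of arXiv:2405.00270v2)]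
[cite: Mazur1978, §6 Prop. 6.3 (1) (p. 153)] [cite: PerrinRiou1987, §1.4 Cor. 1.8] [cite: BalakrishnanMullerStein2015, Thm. 1.7] -/
theorem bsdp_of_ainvs_of_bsdpPartner_of_torsionIso_of_analyticRank_le_one
    (hBCS : burungale_castella_skinner_charIdeal_eq_padicLFunction)
    (hGr : greenberg_charValue_rankZero) (h5 : realPeriodRat_eq_unit_mul_plusPeriod)
    (hGV : GreenbergVatsal2000.thm14_mainConjecture_transfer_of_torsionIso)
    (hS : Schneider1985_order_charGenerator) (hPR : perrinRiou_rankOne_leadingTerms)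
    (hmodP : nonempty_modularParametrizationData) (hmodL : hasEntireLFunction_rat)
    (hGZK : rank_eq_analyticRank_of_analyticRank_le_one)
    (a1 a2 a3 a4 a6 : ℤ) {W : WeierstrassCurve ℚ} [W.IsElliptic] [W.IsGloballyMinimal]
    (hW : integralModelInt W = ⟨a1, a2, a3, a4, a6⟩)
    (b1 b2 b3 b4 b6 : ℤ) {A : WeierstrassCurve ℚ} [A.IsElliptic] [A.IsGloballyMinimal]
    (hA : integralModelInt A = ⟨b1, b2, b3, b4, b6⟩)
    (p ℓ n np npA : ℕ) [Fact p.Prime] [Fact ℓ.Prime] (hp : 5 ≤ p)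
    (hpΔ : ¬ (p : ℤ) ∣ discOf [a1, a2, a3, a4, a6])
    (hcardp : Nat.card (((⟨a1, a2, a3, a4, a6⟩ : WeierstrassCurve ℤ).map
      (Int.castRingHom (ZMod p))).toAffine.Point) = np)
    (hordp : ¬ (p : ℤ) ∣ (p : ℤ) + 1 - np)
    (hℓp : ℓ ≠ p) (hℓΔ : ¬ (ℓ : ℤ) ∣ discOf [a1, a2, a3, a4, a6])
    (hcard : Nat.card (((⟨a1, a2, a3, a4, a6⟩ : WeierstrassCurve ℤ).map
      (Int.castRingHom (ZMod ℓ))).toAffine.Point) = n)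
    (hnoroot : ∀ t : ℕ, t < p → ¬ (p : ℤ) ∣ (t : ℤ) ^ 2 - ((ℓ : ℤ) + 1 - n) * t + ℓ)
    (hpΔA : ¬ (p : ℤ) ∣ discOf [b1, b2, b3, b4, b6])
    (hcardpA : Nat.card (((⟨b1, b2, b3, b4, b6⟩ : WeierstrassCurve ℤ).map
      (Int.castRingHom (ZMod p))).toAffine.Point) = npA)
    (hordpA : ¬ (p : ℤ) ∣ (p : ℤ) + 1 - npA)
    (hran : W.analyticRank ≤ 1) (hrA : A.analyticRank ≤ 1) (hbsdA : BSDp A p)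
    (hSchA : A.analyticRank = 1 → ∀ Dh : PAdicHeightData A p, Dh.IsCanonical → SchneiderConjecture Dh)
    (hcertA : ∀ [NeZero (A.conductorNorm ℤ)] (fA : CuspForm (Gamma0 (A.conductorNorm ℤ)) 2),
        IsNewformOf A fA → ∀ (ϖ : ℚ), (ϖ : ℝ) * A.realPeriodRat = plusPeriod fA →
      ∃ n : ℕ, ‖PowerSeries.coeff n
        (PowerSeries.C (ϖ : ℚ_[p]) * padicLFunction fA (unitRoot A p : ℚ_[p]))‖ = 1)
    (hC1 : ∃ e : geomTorsion A (p : ℤ) ≃+ geomTorsion W (p : ℤ),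
      ∀ (σ : Field.absoluteGaloisGroup ℚ) (P : geomTorsion A (p : ℤ)), e (σ • P) = σ • e P)
    (hC3 : W.analyticRank = 1 → ∀ Dh : PAdicHeightData W p, Dh.IsCanonical → SchneiderConjecture Dh) :
    BSDp W p := by
  obtain ⟨hgood, hord, hirr⟩ := hasGoodReductionAtPrime_and_not_dvd_and_irr_of_ainvs a1 a2 a3 a4 a6 hW p ℓ n
    np hpΔ hcardp hordp hℓp hℓΔ hcard hnoroot
  obtain ⟨hgoodA, hordA⟩ := hasGoodReductionAtPrime_and_not_dvd_of_ainvs b1 b2 b3 b4 b6 hA p npA hpΔA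
    hcardpA hordpA
  exact bsdp_of_bsdpPartner_of_partnerRank_le_one_of_irr W A p hBCS hGr h5 hGV hS hPR hmodP hmodL hGZK
    hran hgood hord hp hirr hgoodA hordA hrA hbsdA hSchA hcertA hC1 hC3

/-- **The same for a target of analytic rank `0`** (no Schneider certificate for the target): gen 15's
`bsdp_of_ainvs_of_bsdpPartner_of_congruences` keyed on `hC1`. [cite: GreenbergVatsal2000, Thm. (1.4) (arXiv p. 5)]
[cite: GreenbergLNM1716, Thm. 4.1 (p. 102)] [cite: Mazur1978, §6 Prop. 6.3 (1) (p. 153)] -/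
theorem bsdp_of_ainvs_of_bsdpPartner_of_torsionIso
    (hBCS : burungale_castella_skinner_charIdeal_eq_padicLFunction)
    (hGr : greenberg_charValue_rankZero) (h5 : realPeriodRat_eq_unit_mul_plusPeriod)
    (hGV : GreenbergVatsal2000.thm14_mainConjecture_transfer_of_torsionIso)
    (hS : Schneider1985_order_charGenerator) (hPR : perrinRiou_rankOne_leadingTerms)
    (hmodP : nonempty_modularParametrizationData) (hmodL : hasEntireLFunction_rat)
    (hGZK : rank_eq_analyticRank_of_analyticRank_le_one)
    (a1 a2 a3 a4 a6 : ℤ) {W : WeierstrassCurve ℚ} [W.IsElliptic] [W.IsGloballyMinimal]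
    (hW : integralModelInt W = ⟨a1, a2, a3, a4, a6⟩)
    (b1 b2 b3 b4 b6 : ℤ) {A : WeierstrassCurve ℚ} [A.IsElliptic] [A.IsGloballyMinimal]
    (hA : integralModelInt A = ⟨b1, b2, b3, b4, b6⟩)
    (p ℓ n np npA : ℕ) [Fact p.Prime] [Fact ℓ.Prime] (hp : 5 ≤ p)
    (hpΔ : ¬ (p : ℤ) ∣ discOf [a1, a2, a3, a4, a6])
    (hcardp : Nat.card (((⟨a1, a2, a3, a4, a6⟩ : WeierstrassCurve ℤ).map
      (Int.castRingHom (ZMod p))).toAffine.Point) = np)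
    (hordp : ¬ (p : ℤ) ∣ (p : ℤ) + 1 - np)
    (hℓp : ℓ ≠ p) (hℓΔ : ¬ (ℓ : ℤ) ∣ discOf [a1, a2, a3, a4, a6])
    (hcard : Nat.card (((⟨a1, a2, a3, a4, a6⟩ : WeierstrassCurve ℤ).map
      (Int.castRingHom (ZMod ℓ))).toAffine.Point) = n)
    (hnoroot : ∀ t : ℕ, t < p → ¬ (p : ℤ) ∣ (t : ℤ) ^ 2 - ((ℓ : ℤ) + 1 - n) * t + ℓ)
    (hpΔA : ¬ (p : ℤ) ∣ discOf [b1, b2, b3, b4, b6])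
    (hcardpA : Nat.card (((⟨b1, b2, b3, b4, b6⟩ : WeierstrassCurve ℤ).map
      (Int.castRingHom (ZMod p))).toAffine.Point) = npA)
    (hordpA : ¬ (p : ℤ) ∣ (p : ℤ) + 1 - npA)
    (hr : W.analyticRank = 0) (hrA : A.analyticRank ≤ 1) (hbsdA : BSDp A p)
    (hSchA : A.analyticRank = 1 → ∀ Dh : PAdicHeightData A p, Dh.IsCanonical → SchneiderConjecture Dh)
    (hcertA : ∀ [NeZero (A.conductorNorm ℤ)] (fA : CuspForm (Gamma0 (A.conductorNorm ℤ)) 2),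
        IsNewformOf A fA → ∀ (ϖ : ℚ), (ϖ : ℝ) * A.realPeriodRat = plusPeriod fA →
      ∃ n : ℕ, ‖PowerSeries.coeff n
        (PowerSeries.C (ϖ : ℚ_[p]) * padicLFunction fA (unitRoot A p : ℚ_[p]))‖ = 1)
    (hC1 : ∃ e : geomTorsion A (p : ℤ) ≃+ geomTorsion W (p : ℤ),
      ∀ (σ : Field.absoluteGaloisGroup ℚ) (P : geomTorsion A (p : ℤ)), e (σ • P) = σ • e P) :
    BSDp W p :=
  bsdp_of_ainvs_of_bsdpPartner_of_torsionIso_of_analyticRank_le_one hBCS hGr h5 hGV hS hPR hmodP hmodL hGZK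
    a1 a2 a3 a4 a6 hW b1 b2 b3 b4 b6 hA p ℓ n np npA hp hpΔ hcardp hordp hℓp hℓΔ hcard hnoroot hpΔA hcardpA hordpA
    (by rw [hr]; norm_num) hrA hbsdA hSchA hcertA hC1 (fun h1 ↦ absurd h1 (by rw [hr]; norm_num))

/-- **Partner of conductor `< 5000`: `BSD(A,p)` DISCHARGED by Miller 2011 / Creutz–Miller 2012** (`hMiller` =
`bsdp_of_irreducible_of_conductor_lt`: "`r_an(A) ≤ 1`, `N_A < 5000`, `A[p]` irreducible ⟹ `BSD(A,p)`"; `A[p]` is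
irreducible because `E[p]` is, along `hC1`) — gen 16's
`bsdp_of_ainvs_of_conductor_lt_of_congruences_of_analyticRank_le_one` keyed on `hC1`.
[cite: Miller2011LMS, Thm. 1.2] [cite: CreutzMiller2012, Thm. 1.1] [cite: GreenbergVatsal2000, Thm. (1.4) (arXiv p. 5)]
[cite: Mazur1978, §6 Prop. 6.3 (1) (p. 153)] -/
theorem bsdp_of_ainvs_of_conductor_lt_of_torsionIso_of_analyticRank_le_one
    (hMiller : bsdp_of_irreducible_of_conductor_lt)
    (hBCS : burungale_castella_skinner_charIdeal_eq_padicLFunction)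
    (hGr : greenberg_charValue_rankZero) (h5 : realPeriodRat_eq_unit_mul_plusPeriod)
    (hGV : GreenbergVatsal2000.thm14_mainConjecture_transfer_of_torsionIso)
    (hS : Schneider1985_order_charGenerator) (hPR : perrinRiou_rankOne_leadingTerms)
    (hmodP : nonempty_modularParametrizationData) (hmodL : hasEntireLFunction_rat)
    (hGZK : rank_eq_analyticRank_of_analyticRank_le_one)
    (a1 a2 a3 a4 a6 : ℤ) {W : WeierstrassCurve ℚ} [W.IsElliptic] [W.IsGloballyMinimal]
    (hW : integralModelInt W = ⟨a1, a2, a3, a4, a6⟩)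
    (b1 b2 b3 b4 b6 : ℤ) {A : WeierstrassCurve ℚ} [A.IsElliptic] [A.IsGloballyMinimal]
    (hA : integralModelInt A = ⟨b1, b2, b3, b4, b6⟩)
    (p ℓ n np npA : ℕ) [Fact p.Prime] [Fact ℓ.Prime] (hp : 5 ≤ p)
    (hpΔ : ¬ (p : ℤ) ∣ discOf [a1, a2, a3, a4, a6])
    (hcardp : Nat.card (((⟨a1, a2, a3, a4, a6⟩ : WeierstrassCurve ℤ).map
      (Int.castRingHom (ZMod p))).toAffine.Point) = np)
    (hordp : ¬ (p : ℤ) ∣ (p : ℤ) + 1 - np)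
    (hℓp : ℓ ≠ p) (hℓΔ : ¬ (ℓ : ℤ) ∣ discOf [a1, a2, a3, a4, a6])
    (hcard : Nat.card (((⟨a1, a2, a3, a4, a6⟩ : WeierstrassCurve ℤ).map
      (Int.castRingHom (ZMod ℓ))).toAffine.Point) = n)
    (hnoroot : ∀ t : ℕ, t < p → ¬ (p : ℤ) ∣ (t : ℤ) ^ 2 - ((ℓ : ℤ) + 1 - n) * t + ℓ)
    (hpΔA : ¬ (p : ℤ) ∣ discOf [b1, b2, b3, b4, b6])
    (hcardpA : Nat.card (((⟨b1, b2, b3, b4, b6⟩ : WeierstrassCurve ℤ).map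
      (Int.castRingHom (ZMod p))).toAffine.Point) = npA)
    (hordpA : ¬ (p : ℤ) ∣ (p : ℤ) + 1 - npA)
    (hran : W.analyticRank ≤ 1) (hrA : A.analyticRank ≤ 1) (hNA : A.conductorNorm ℤ < 5000)
    (hSchA : A.analyticRank = 1 → ∀ Dh : PAdicHeightData A p, Dh.IsCanonical → SchneiderConjecture Dh)
    (hcertA : ∀ [NeZero (A.conductorNorm ℤ)] (fA : CuspForm (Gamma0 (A.conductorNorm ℤ)) 2),
        IsNewformOf A fA → ∀ (ϖ : ℚ), (ϖ : ℝ) * A.realPeriodRat = plusPeriod fA →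
      ∃ n : ℕ, ‖PowerSeries.coeff n
        (PowerSeries.C (ϖ : ℚ_[p]) * padicLFunction fA (unitRoot A p : ℚ_[p]))‖ = 1)
    (hC1 : ∃ e : geomTorsion A (p : ℤ) ≃+ geomTorsion W (p : ℤ),
      ∀ (σ : Field.absoluteGaloisGroup ℚ) (P : geomTorsion A (p : ℤ)), e (σ • P) = σ • e P)
    (hC3 : W.analyticRank = 1 → ∀ Dh : PAdicHeightData W p, Dh.IsCanonical → SchneiderConjecture Dh) :
    BSDp W p := by
  obtain ⟨hgood, hord, hirr⟩ := hasGoodReductionAtPrime_and_not_dvd_and_irr_of_ainvs a1 a2 a3 a4 a6 hW p ℓ n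
    np hpΔ hcardp hordp hℓp hℓΔ hcard hnoroot
  obtain ⟨hgoodA, hordA⟩ := hasGoodReductionAtPrime_and_not_dvd_of_ainvs b1 b2 b3 b4 b6 hA p npA hpΔA
    hcardpA hordpA
  obtain ⟨e, he⟩ := hC1
  have hirrA : A.HasIrreducibleModPGaloisRep p := hasIrreducibleModPGaloisRep_of_torsionIso_symm e he hirr
  exact bsdp_of_bsdpPartner_of_partnerRank_le_one_of_irr W A p hBCS hGr h5 hGV hS hPR hmodP hmodL hGZK
    hran hgood hord hp hirr hgoodA hordA hrA (hMiller A hrA hNA p Fact.out hirrA) hSchA hcertA ⟨e, he⟩ hC3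

end Summit.BirchSwinnertonDyer.Rank1Residual.X9

end
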